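import Literature.GroupTheory.CombinatorialGroupTheory.RandomSclFreeGroupMatchedChunks
import HarnessLib

/-!
# Random rigidity of scl (Calegari–Walker 2013): proofs, part 10 — matching chunks by type

D. Calegari, A. Walker, *Random rigidity in the free group*, Geom. Topol. 17 (2013)
[CalegariWalker2013], §4.3: the upper bound for `scl` of a random word is certified by a fatgraph
whose edges are matched pairs of (long) subwords `σ`, `σ⁻¹`; such pairs are plentiful because
the subwords of a fixed length at the positions of a grid are (almost) equidistributed among the
possible types (Prop. 2.3 / Lemma 2.5), so that the chunks of type `σ` can be matched with the
chunks of type `σ⁻¹` up to a small discrepancy.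

Here is the deterministic matching step, on top of `commutatorLength_le_of_matchedChunks`:

* **`commutatorLength_le_of_chunkCounts`** — let `w` be a balanced word of length `n` and
  `s 0, …, s (T−1)` the starts of `T` pairwise disjoint chunks of length `ℓ + 1`, none of which is
  its own inverse word. Let `c σ` be the number of chunks of type `σ` and
  `D = ∑_σ (c σ − c σ⁻¹)₊` (sum over the occurring types) the matching discrepancy. Then
  `4 cl(w) + ℓ (T − D) ≤ n + 2`.
-/

noncomputable section

namespace Literature.GroupTheory.CombinatorialGroupTheory

section ChunkMatching

open Equiv

/-- **Matching chunks by type (CW §4.3, deterministic form).** Let `w` be a balanced word of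
length `n`, `s : Fin T → ℕ` the starts of pairwise disjoint chunks `[s t, s t + ℓ]`, none equal to
its own inverse word, `c σ = #{t : chunk t = σ}` and `D = ∑_{σ occurring} (c σ − c σ⁻¹)₊`. Then
`4 · cl(w) + ℓ · (T − D) ≤ n + 2`: match, for every pair of types `{σ, σ⁻¹}`, `min(c σ, c σ⁻¹)`
chunks of type `σ` with chunks of type `σ⁻¹` and apply `commutatorLength_le_of_matchedChunks`.
[cite: CalegariWalker2013, §4.3] -/
theorem commutatorLength_le_of_chunkCounts {α : Type*} [DecidableEq α] {n : ℕ}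
    (w : Fin n → α × Bool) (hw : FreeGroup.mk (List.ofFn w) ∈ commutator (FreeGroup α))
    (ℓ T : ℕ) (s : Fin T → ℕ) (hs : ∀ t, s t + ℓ < n)
    (hdisj : ∀ t t', t ≠ t' → s t + ℓ < s t' ∨ s t' + ℓ < s t)
    (hself : ∀ t, (fun q : Fin (ℓ + 1) => w ⟨s t + q, by have := hs t; omega⟩) ≠
      fun q : Fin (ℓ + 1) => ((w ⟨s t + (ℓ - q), by have := hs t; omega⟩).1,
        !(w ⟨s t + (ℓ - q), by have := hs t; omega⟩).2)) :
    4 * commutatorLength (FreeGroup.mk (List.ofFn w)) + ℓ * (T -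
      ∑ σ ∈ (Finset.univ : Finset (Fin T)).image (fun t => fun q : Fin (ℓ + 1) =>
          w ⟨s t + q, by have := hs t; omega⟩),
        ((Finset.univ.filter fun t : Fin T => (fun q : Fin (ℓ + 1) =>
            w ⟨s t + q, by have := hs t; omega⟩) = σ).card -
          (Finset.univ.filter fun t : Fin T => (fun q : Fin (ℓ + 1) =>
            w ⟨s t + q, by have := hs t; omega⟩) = fun q : Fin (ℓ + 1) =>
              ((σ ⟨ℓ - q, by omega⟩).1, !(σ ⟨ℓ - q, by omega⟩).2)).card)) ≤ n + 2 := by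
  classical
  -- types, inverse types, fibres
  set typ : Fin T → (Fin (ℓ + 1) → α × Bool) := fun t q => w ⟨s t + q, by have := hs t; omega⟩
    with htyp
  set inv : (Fin (ℓ + 1) → α × Bool) → (Fin (ℓ + 1) → α × Bool) := fun σ q =>
    ((σ ⟨ℓ - q, by omega⟩).1, !(σ ⟨ℓ - q, by omega⟩).2) with hinv
  have hinv2 : ∀ σ, inv (inv σ) = σ := by
    intro σ
    funext q
    simp only [hinv, Bool.not_not]
    have e : (⟨ℓ - (ℓ - (q : ℕ)), by omega⟩ : Fin (ℓ + 1)) = q := Fin.ext (by simp only; omega)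
    rw [e]
  have hinvinj : Function.Injective inv := fun σ σ' h => by rw [← hinv2 σ, h, hinv2]
  set A : (Fin (ℓ + 1) → α × Bool) → Finset (Fin T) := fun σ => Finset.univ.filter fun t => typ t = σ
    with hA
  set c : (Fin (ℓ + 1) → α × Bool) → ℕ := fun σ => (A σ).card with hc
  set Types := (Finset.univ : Finset (Fin T)).image typ with hTypes
  show 4 * commutatorLength (FreeGroup.mk (List.ofFn w)) +
    ℓ * (T - ∑ σ ∈ Types, (c σ - c (inv σ))) ≤ n + 2
  have hself' : ∀ t, typ t ≠ inv (typ t) := fun t => hself t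
  -- orientation of the pairs `{σ, σ⁻¹}` by a numbering of the occurring types
  let code : (Fin (ℓ + 1) → α × Bool) → ℕ := fun σ =>
    if h : σ ∈ Types then (Types.equivFin ⟨σ, h⟩ : ℕ) else 0
  have hcode : ∀ σ ∈ Types, ∀ σ' ∈ Types, code σ = code σ' → σ = σ' := by
    intro σ hσ σ' hσ' h
    simp only [code, dif_pos hσ, dif_pos hσ'] at h
    have := Types.equivFin.injective (Fin.ext h)
    exact congrArg Subtype.val this
  set L := Types.filter fun σ => inv σ ∈ Types ∧ code σ < code (inv σ) with hL
  set R := Types.filter fun σ => inv σ ∈ Types ∧ code (inv σ) < code σ with hR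
  -- enumeration of the fibres
  let e : ∀ σ, Fin (c σ) ≃o (A σ) := fun σ => (A σ).orderIsoOfFin rfl
  have he_mem : ∀ σ (i : Fin (c σ)), ((e σ i : Fin T)) ∈ A σ := fun σ i => (e σ i).2
  have he_typ : ∀ σ (i : Fin (c σ)), typ (e σ i : Fin T) = σ := fun σ i =>
    (Finset.mem_filter.mp (he_mem σ i)).2
  -- the matched pairs, indexed by `(σ, i)` with `σ ∈ L`, `i < min (c σ) (c σ⁻¹)`
  set PairSet : Finset (Σ _ : (Fin (ℓ + 1) → α × Bool), ℕ) :=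
    L.sigma fun σ => Finset.range (min (c σ) (c (inv σ))) with hPairSet
  set M := PairSet.card with hM
  let enum : Fin M ≃ PairSet := PairSet.equivFin.symm
  have henum : ∀ r : Fin M, (enum r).1.1 ∈ L ∧
      (enum r).1.2 < min (c (enum r).1.1) (c (inv (enum r).1.1)) := by
    intro r
    have h := (enum r).2
    obtain ⟨h1, h2⟩ := Finset.mem_sigma.mp h
    exact ⟨h1, Finset.mem_range.mp h2⟩
  -- left and right slots of a pair
  let lslot : Fin M → Fin T := fun r => e (enum r).1.1 ⟨(enum r).1.2,
    lt_of_lt_of_le (henum r).2 (min_le_left _ _)⟩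
  let rslot : Fin M → Fin T := fun r => e (inv (enum r).1.1) ⟨(enum r).1.2,
    lt_of_lt_of_le (henum r).2 (min_le_right _ _)⟩
  have hltyp : ∀ r, typ (lslot r) = (enum r).1.1 := fun r => he_typ _ _
  have hrtyp : ∀ r, typ (rslot r) = inv (enum r).1.1 := fun r => he_typ _ _
  have hLmem : ∀ r, (enum r).1.1 ∈ L := fun r => (henum r).1
  have hLprop : ∀ σ ∈ L, σ ∈ Types ∧ inv σ ∈ Types ∧ code σ < code (inv σ) := by
    intro σ hσ
    rw [hL, Finset.mem_filter] at hσ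
    exact ⟨hσ.1, hσ.2.1, hσ.2.2⟩
  -- recovering the pair from a slot
  let back : Fin T → (Σ _ : (Fin (ℓ + 1) → α × Bool), ℕ) := fun t =>
    ⟨typ t, (((e (typ t)).symm ⟨t, by rw [hA, Finset.mem_filter]; exact ⟨Finset.mem_univ _, rfl⟩⟩
      : Fin (c (typ t))) : ℕ)⟩
  have hidx : ∀ (σ τ' : Fin (ℓ + 1) → α × Bool) (i : Fin (c σ)) (h : σ = τ')
      (hm : (e σ i : Fin T) ∈ A τ'), (((e τ').symm ⟨e σ i, hm⟩ : Fin (c τ')) : ℕ) = i := by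
    intro σ τ' i h hm
    subst h
    have : (⟨(e σ i : Fin T), hm⟩ : A σ) = e σ i := Subtype.ext rfl
    rw [this, OrderIso.symm_apply_apply]
  have hback_l : ∀ r, back (lslot r) = (enum r).1 := by
    intro r
    refine Sigma.ext (hltyp r) (heq_of_eq ?_)
    show (((e (typ (lslot r))).symm ⟨lslot r, _⟩ : Fin (c (typ (lslot r)))) : ℕ) = (enum r).1.2
    exact hidx _ _ _ (hltyp r).symm _
  have hback_r : ∀ r, back (rslot r) = ⟨inv (enum r).1.1, (enum r).1.2⟩ := by
    intro r
    refine Sigma.ext (hrtyp r) (heq_of_eq ?_)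
    show (((e (typ (rslot r))).symm ⟨rslot r, _⟩ : Fin (c (typ (rslot r)))) : ℕ) = (enum r).1.2
    exact hidx _ _ _ (hrtyp r).symm _
  have hlr : ∀ r r' : Fin M, lslot r ≠ rslot r' := by
    intro r r' h'
    have h1 : typ (lslot r) = typ (rslot r') := by rw [h']
    rw [hltyp, hrtyp] at h1
    have h2 : inv (enum r).1.1 = (enum r').1.1 := by rw [h1, hinv2]
    obtain ⟨_, _, hlt⟩ := hLprop _ (hLmem r)
    obtain ⟨_, _, hlt'⟩ := hLprop _ (hLmem r')
    rw [h2] at hlt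
    rw [← h1] at hlt'
    exact lt_asymm hlt hlt'
  have hll : ∀ r r' : Fin M, lslot r = lslot r' → r = r' := by
    intro r r' h
    have h1 := hback_l r
    rw [h, hback_l r'] at h1
    exact enum.injective (Subtype.ext h1.symm)
  have hrr : ∀ r r' : Fin M, rslot r = rslot r' → r = r' := by
    intro r r' h
    have h1 := hback_r r
    rw [h, hback_r r'] at h1
    have h2 : (enum r').1.1 = (enum r).1.1 :=
      hinvinj (congrArg Sigma.fst h1)
    have h3 : (enum r').1.2 = (enum r).1.2 := by
      have := congrArg Sigma.snd h1
      exact eq_of_heq (this ▸ HEq.rfl)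
    exact (enum.injective (Subtype.ext (Sigma.ext h2 (heq_of_eq h3)))).symm
  -- the position map
  have hlen : (List.ofFn w).length = n := List.length_ofFn
  let slot : Fin M × Bool → Fin T := fun x => if x.2 then rslot x.1 else lslot x.1
  have hslot_inj : Function.Injective slot := by
    rintro ⟨r, b⟩ ⟨r', b'⟩ h
    simp only [slot] at h
    cases b <;> cases b' <;> simp only [Bool.false_eq_true, ↓reduceIte] at h
    · rw [hll r r' h]
    · exact absurd h (hlr r r')
    · exact absurd h.symm (hlr r' r)
    · rw [hrr r r' h]
  let pos : Fin M × Fin (ℓ + 1) × Bool → Fin (List.ofFn w).length := fun x =>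
    ⟨s (slot (x.1, x.2.2)) + x.2.1, by rw [hlen]; have := hs (slot (x.1, x.2.2)); omega⟩
  -- slots are determined by any of their positions
  have hslot : ∀ (t t' : Fin T) (q q' : ℕ), q ≤ ℓ → q' ≤ ℓ → s t + q = s t' + q' → t = t' := by
    intro t t' q q' hq hq' h
    by_contra hne
    rcases hdisj t t' hne with h1 | h1 <;> omega
  have hpos_inj : Function.Injective pos := by
    rintro ⟨r, q, b⟩ ⟨r', q', b'⟩ h
    have hv := congrArg Fin.val h
    simp only [pos] at hv
    have hsl := hslot _ _ q q' (by omega) (by omega) hv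
    have hq : q = q' := by
      apply Fin.ext
      rw [hsl] at hv
      omega
    subst hq
    have hrb := hslot_inj hsl
    simp only [Prod.mk.injEq] at hrb
    obtain ⟨rfl, rfl⟩ := hrb
    rfl
  have hPq : ∀ r q b, ((pos (r, q, b) : Fin (List.ofFn w).length) : ℕ) =
      (pos (r, 0, b) : ℕ) + q := by
    intro r q b
    simp only [pos, Fin.val_zero, add_zero]
  have hget : ∀ (t : Fin T) (q : ℕ) (hq : q ≤ ℓ) (h : s t + q < (List.ofFn w).length),
      (List.ofFn w).get ⟨s t + q, h⟩ = w ⟨s t + q, by have := hs t; omega⟩ := by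
    intro t q hq h
    simp only [List.get_eq_getElem, List.getElem_ofFn]
  have hinvP : ∀ r (q : Fin (ℓ + 1)), (List.ofFn w).get (pos (r, ⟨ℓ - q, by omega⟩, true)) =
      (((List.ofFn w).get (pos (r, q, false))).1, !((List.ofFn w).get (pos (r, q, false))).2) := by
    intro r q
    have hq := q.isLt
    have e1 : (List.ofFn w).get (pos (r, ⟨ℓ - q, by omega⟩, true)) = typ (rslot r) ⟨ℓ - q, by omega⟩ := by
      show (List.ofFn w).get ⟨s (rslot r) + (ℓ - q), _⟩ = _
      rw [hget (rslot r) (ℓ - q) (by omega)]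
    have e2 : (List.ofFn w).get (pos (r, q, false)) = typ (lslot r) q := by
      show (List.ofFn w).get ⟨s (lslot r) + q, _⟩ = _
      rw [hget (lslot r) q (by omega)]
    rw [e1, e2, hrtyp, hltyp]
    simp only [hinv]
    have e3 : (⟨ℓ - (ℓ - (q : ℕ)), by omega⟩ : Fin (ℓ + 1)) = q := Fin.ext (by simp only; omega)
    rw [e3]
  -- the surface bound
  have hmain := commutatorLength_le_of_matchedChunks (List.ofFn w) hw ℓ M pos hpos_inj hPq hinvP
  rw [hlen] at hmain
  -- counting: `2 M = ∑_{Types} min (c σ) (c σ⁻¹) = T - D`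
  have hMcard : M = ∑ σ ∈ L, min (c σ) (c (inv σ)) := by
    rw [hM, hPairSet, Finset.card_sigma]
    simp only [Finset.card_range]
  have hTsum : ∑ σ ∈ Types, c σ = T := by
    have := Finset.card_eq_sum_card_fiberwise (s := (Finset.univ : Finset (Fin T))) (t := Types)
      (f := typ) (fun t _ => Finset.mem_image_of_mem typ (Finset.mem_univ t))
    rw [Finset.card_univ, Fintype.card_fin] at this
    rw [this]
  have hDle : ∑ σ ∈ Types, (c σ - c (inv σ)) ≤ T := by
    rw [← hTsum]
    exact Finset.sum_le_sum fun σ _ => Nat.sub_le _ _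
  have hmin : ∑ σ ∈ Types, min (c σ) (c (inv σ)) = T - ∑ σ ∈ Types, (c σ - c (inv σ)) := by
    rw [← hTsum, ← Finset.sum_tsub_distrib Types (fun σ _ => Nat.sub_le (c σ) (c (inv σ)))]
    refine Finset.sum_congr rfl fun σ _ => ?_
    omega
  -- types whose inverse does not occur contribute nothing
  have hzero : ∀ σ ∈ Types, inv σ ∉ Types → min (c σ) (c (inv σ)) = 0 := by
    intro σ _ hninv
    have : c (inv σ) = 0 := by
      rw [hc]
      simp only
      rw [Finset.card_eq_zero, hA, Finset.filter_eq_empty_iff]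
      intro t _ ht
      exact hninv (by rw [hTypes, Finset.mem_image]; exact ⟨t, Finset.mem_univ _, ht⟩)
    rw [this, Nat.min_zero]
  -- occurring types are never self-inverse
  have hTself : ∀ σ ∈ Types, σ ≠ inv σ := by
    intro σ hσ
    rw [hTypes, Finset.mem_image] at hσ
    obtain ⟨t, _, rfl⟩ := hσ
    exact hself' t
  have hsplit : ∑ σ ∈ Types, min (c σ) (c (inv σ)) =
      ∑ σ ∈ L, min (c σ) (c (inv σ)) + ∑ σ ∈ R, min (c σ) (c (inv σ)) := by
    rw [← Finset.sum_filter_add_sum_filter_not Types (fun σ => inv σ ∈ Types)]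
    have h0 : ∑ σ ∈ Types.filter (fun σ => ¬ inv σ ∈ Types), min (c σ) (c (inv σ)) = 0 := by
      refine Finset.sum_eq_zero fun σ hσ => ?_
      rw [Finset.mem_filter] at hσ
      exact hzero σ hσ.1 hσ.2
    rw [h0, add_zero]
    have hLR : Types.filter (fun σ => inv σ ∈ Types) = L ∪ R := by
      ext σ
      rw [Finset.mem_union, hL, hR, Finset.mem_filter, Finset.mem_filter, Finset.mem_filter]
      constructor
      · rintro ⟨hσ, hiσ⟩
        have hne : code σ ≠ code (inv σ) := fun h => hTself σ hσ (hcode σ hσ _ hiσ h)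
        rcases lt_or_gt_of_ne hne with h | h
        · exact Or.inl ⟨hσ, hiσ, h⟩
        · exact Or.inr ⟨hσ, hiσ, h⟩
      · rintro (⟨hσ, hiσ, _⟩ | ⟨hσ, hiσ, _⟩) <;> exact ⟨hσ, hiσ⟩
    have hdisjLR : Disjoint L R := by
      rw [Finset.disjoint_left]
      intro σ hσL hσR
      rw [hL, Finset.mem_filter] at hσL
      rw [hR, Finset.mem_filter] at hσR
      exact lt_asymm hσL.2.2 hσR.2.2
    rw [hLR, Finset.sum_union hdisjLR]
  have hRL : ∑ σ ∈ R, min (c σ) (c (inv σ)) = ∑ σ ∈ L, min (c σ) (c (inv σ)) := by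
    refine Finset.sum_nbij' inv inv ?_ ?_ (fun σ _ => hinv2 σ) (fun σ _ => hinv2 σ) ?_
    · intro σ hσ
      rw [hR, Finset.mem_filter] at hσ
      rw [hL, Finset.mem_filter, hinv2]
      exact ⟨hσ.2.1, hσ.1, hσ.2.2⟩
    · intro σ hσ
      rw [hL, Finset.mem_filter] at hσ
      rw [hR, Finset.mem_filter, hinv2]
      exact ⟨hσ.2.1, hσ.1, hσ.2.2⟩
    · intro σ _
      rw [hinv2, min_comm]
  have h2M : T - ∑ σ ∈ Types, (c σ - c (inv σ)) = 2 * M := by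
    rw [← hmin, hsplit, hRL, hMcard]
    ring
  rw [h2M]
  have : ℓ * (2 * M) = 2 * ℓ * M := by ring
  rw [this]
  exact hmain

end ChunkMatching

end Literature.GroupTheory.CombinatorialGroupTheory

end
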